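import Summits.KontsevichZagierPeriods.KontsevichZagierPeriods.Theses.RootDecompZetaThreeFrontier
import Summits.KontsevichZagierPeriods.KontsevichZagierPeriods.Theses.LinRedNormalForm
import Literature.NumberTheory.Transcendental.MultipleZetaValuesHoffmanProofs
import Literature.NumberTheory.Transcendental.MultipleZetaRepeatedTwosProofs
import Literature.NumberTheory.Transcendental.MultipleZetaDepthTwoProofs
import Literature.NumberTheory.Transcendental.MultipleZetaHoffmanRelationProofs
import Literature.NumberTheory.Transcendental.MZVSimplexRepProofs
import HarnessLib
import Summits.KontsevichZagierPeriods.KontsevichZagierPeriods.Theorems.RootDecompZetaThreeFrontierSupportCollapse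
import Summits.KontsevichZagierPeriods.KontsevichZagierPeriods.Theorems.RootDecompZetaThreeFrontierWordMoves
import Summits.KontsevichZagierPeriods.KontsevichZagierPeriods.Theorems.RootDecompZetaThreeFrontierGZLadderThreeWlog

/-!
# decomp-kz lens-1 gen 11 — `RungTwo.lean`: RUNG K = 2 OF THE WEIGHT–DIMENSION LADDER (`gzNormalFormW_two`) and the REGISTERED stub
`gz_ladder.stub_le_two` (skeleton v3 @1c2778ca on stmt-KontsevichZagierPeriods-32433) BY NAME AND SIGNATURE — SELF-CONTAINED LANDING UNIT.

Census-1 g8 request shape (bus 14:05:58Z): ONE file = the dependency cone of `WordLayer.gzNormalFormW_two` inside lens-1's `WordLayer.lean` v2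
(@a8e3aac9, 8642 l; g9 §12 rung 1, §15–§16 corner classes, §19 γ-step, §20 corner layer, §21 necessity on `Δ₂` + assembly — extracted mechanically,
decl blocks verbatim, namespace `Summit.KontsevichZagierPeriods.RootDecompZetaThreeFrontier.WordLayer` unchanged), importing only landed modules, and
ending with the by-name block that imports `…Theorems.RootDecompZetaThreeFrontierGZLadderThreeWlog` for `simplex` / `IsGZ` (NOT re-declared) and declares
only `words`, `CongInto`, `words_eq_wordGensLE`, `stub_le_two`.  farm `lean check`: rc 0, 0 errors, 0 warnings, 0 sorries; standard axioms (audit pinned).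
-/

/-! # `RootDecompZetaThreeFrontierWordRungTwoP1` — part 1/12 of the mechanical ≤270-line split of `RungTwo.stripped.lean`
(split by the decomp-kz census seat for landing; mathematics unchanged). -/

noncomputable section

namespace Summit.KontsevichZagierPeriods.RootDecompZetaThreeFrontier.WordLayer
open Set MeasureTheory MvPolynomial
open Literature.NumberTheory.Transcendental
open Summit.KontsevichZagierPeriods.KontsevichZagierPeriods.Theses.RootDecompZetaThreeFrontier
  (HigherWeightDescent)
open Summit.KontsevichZagierPeriods.KontsevichZagierPeriods.Theses.LinRedNormalForm
  (DihedralNormalForm MzvKernelInKZ HoffmanSpanInKZ HoffmanIndependence)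
/-! ## §0 Word representations are genus-zero representations -/

section WordIsGZ
variable {w : ℕ}
/-- The word integrand `q · ∏ᵢ ω_{εᵢ}(tᵢ)`, literally as inlined in items 3912 / 3914 / 15044
(= the disprover's `Negative.wordFun`). -/
def wordFun (ε : Fin w → Bool) (q : ℚ) (t : Fin w → ℝ) : ℝ :=
  (q : ℝ) * ∏ i, if ε i then 1 / (1 - t i) else 1 / t i

/-- Kontsevich's integrand of an index is the word integrand of its binary word (coefficient `1`). -/
theorem mzvIntegrand_eq_wordFun (u : List ℕ) (t : Fin (MZV.weight u) → ℝ) :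
    KZ.mzvIntegrand u t = wordFun (fun i => (MZV.binaryWord u).getD i false) 1 t := by
  simp only [wordFun, Rat.cast_one, one_mul]
  rfl

end WordIsGZ
/-! ## §1 Un-mixing item 27223; the genus-zero half from route `LinRedNormalForm` by name -/

/-! ## §2 The homogeneous word slices of 27223 and the weight-`w` kernel -/

/-! ## §3 The weight-graded kernel transfer `SpanAt N → InWeight N → WeightKernelAt N` -/

section Engine
/-- Hoffman indices of weight `N` (a finite type: `finite_hoffman`). -/
abbrev HIdx (N : ℕ) : Type := {u : List ℕ // MZV.IsHoffman u ∧ MZV.weight u = N}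

/-- The canonical Hoffman representation `[Δ_N, q·ω_u]` (Kontsevich's simplex representation from
`Literature`, scaled by the rational constant inside the integrand). -/
def canon {N : ℕ} (u : HIdx N) (q : ℚ) : KZ.IntegralRep (MZV.weight u.1) :=
  KZ.IntegralRep.constMul ((q : ℚ) : ℝ) (isAlgebraic_algebraMap (q : ℚ))
    (KZ.mzvRep u.1 u.2.1.isAdmissible (KZ.mzvIntegrand_isSemialgebraicFunOn_holds u.1)
      (KZ.mzvIntegrand_integrableOn_holds u.1 u.2.1.isAdmissible))

variable {N : ℕ}
/-- A representation whose integrand vanishes on its domain is a relation (rule 1b: `f = f + f`). -/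
private theorem of_mem_relations_of_integrand_zero {n : ℕ} (z : KZ.IntegralRep n)
    (hz : ∀ x ∈ z.domain, z.integrand x = 0) : KZ.of z ∈ KZ.relations := by
  have h3 : KZ.of z - KZ.of z - KZ.of z ∈ KZ.relations :=
    KZ.integrandAddRel_subset_relations ⟨n, z, z, z, rfl, rfl, fun x hx => by simp [hz x hx], rfl⟩
  rw [show KZ.of z - KZ.of z - KZ.of z = -KZ.of z by abel] at h3
  exact neg_mem_iff.mp h3

end Engine
/-! ## §4 The transcendence input `InWeight N`, weight by weight -/

section Rungs
end Rungs
/-! ## §5 The rungs of 27223's word layer -/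

section WordRungs
end WordRungs
/-! ## §6 Mixing weights: the dimension-`≤ N` word kernel costs the GRADING transcendence at once -/

section Mixed
/-- Word generators of weight `≤ N` (all weights `w ≤ N` together). -/
def wordGensLE (N : ℕ) : Set KZ.FormalRep :=
  {x | ∃ (w : ℕ) (ε : Fin w → Bool) (q : ℚ) (s : KZ.IntegralRep w), w ≤ N ∧
    s.domain = {t | (∀ i, 0 < t i) ∧ (∀ i, t i < 1) ∧ StrictAnti t} ∧
    EqOn s.integrand (fun t => (q : ℝ) * ∏ i, if ε i then 1 / (1 - t i) else 1 / t i) s.domain ∧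
    x = KZ.of s}

variable {N : ℕ}
end Mixed
/-! ## §7 Grading the normal form 3912 (`DihedralNormalForm`) by DIMENSION — critic g8 ask (i)

The genus-zero representations of dimension `k` are the period integrals of `M_{0,k+3}` in simplicial
coordinates; item 3912 asks for their normal form in every dimension.  Its truncation at dimension
`≤ K` is a ladder `DihedralNormalFormLE K` whose rung `K = 3` (`M_{0,n}`, `n ≤ 6`) is DECIDED: it is,
token for token, the tree theorem `DihedralNormalForm.TorusDescent.dihedralNormalForm_le_three`
(`dihedralNormalFormLE_three_iff_tree` is `Iff.rfl`).  The weight-sharpened form `GZNormalFormW K`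
(words of weight `≤` the dimension — what every unfolding proof outputs: the exit of the landed chain,
`stub_wordAtomChart d`, sends a dimension-`d` word atom to the weight-`d` word) composes with §6's
MIXED kernel: `GZNormalFormW K → MixedKernelLE K → HigherWeightDescentGZLE K`, the genus-zero half of
27223 truncated at dimension `K`; its first non-vacuous rung is `K = 4` (`M_{0,7}`). -/

section DihedralGrading
/-- **Weight-sharpened graded normal form**: every genus-zero representation of dimension `k ≤ K` is
congruent to a `ℤ`-combination of word representations of weight `≤ k` (§6's `wordGensLE k`). -/
def GZNormalFormW (K : ℕ) : Prop :=
  ∀ (k : ℕ), k ≤ K → ∀ (r : KZ.IntegralRep k) (p : MvPolynomial (Fin k) ℚ)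
    (a : Fin k → Fin k → ℕ) (b c : Fin k → ℕ),
    r.domain = {t | (∀ i, 0 < t i) ∧ (∀ i, t i < 1) ∧ StrictAnti t} →
    Set.EqOn r.integrand (fun t => MvPolynomial.aeval t p / ((∏ i, t i ^ b i) *
      (∏ i, (1 - t i) ^ c i) * ∏ i, ∏ j, if i < j then (t i - t j) ^ a i j else 1)) r.domain →
    ∃ m ∈ AddSubgroup.closure (wordGensLE k), KZ.of r - m ∈ KZ.relations

/-- Auxiliary step `wordGensLE_mono`. [bookkeeping] -/
theorem wordGensLE_mono {k K : ℕ} (h : k ≤ K) : wordGensLE k ⊆ wordGensLE K := by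
  rintro x ⟨w, ε, q, s, hw, hd, hi, rfl⟩
  exact ⟨w, ε, q, s, hw.trans h, hd, hi, rfl⟩

/-! ### The transcendence input of the mixed ladder, rung by rung: `InWeightLE 4` over `InWeightLE 3` -/

end DihedralGrading
section WeightFour
/-! ### 8a  The relation lattice at weight 4 (arithmetic certificate).  Coordinates: the admissible
weight-4 words `ζ(4) = ω₀ω₀ω₀ω₁`, `ζ(3,1) = ω₀ω₀ω₁ω₁`, `ζ(2,2) = ω₀ω₁ω₀ω₁`, `ζ(2,1,1) = ω₀ω₁ω₁ω₁`, values
`(π⁴/360)·(4, 1, 3, 4)` (`Literature`: `multipleZeta_four`, `_three_one`, `_two_two`, `_two_one_one`). -/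

/-! ### 8b  Inside the calculus: canonical representatives and the lattice of their relations -/

/-- Kontsevich's simplex representation of an admissible index with a rational coefficient inside the
integrand, `[Δ_w, q·ω_u]` (`Literature`: `KZ.mzvRep`, `KZ.IntegralRep.constMul`; for a Hoffman index
this is §3's `canon`). -/
def canonA (u : List ℕ) (hu : MZV.IsAdmissible u) (q : ℚ) : KZ.IntegralRep (MZV.weight u) :=
  KZ.IntegralRep.constMul ((q : ℚ) : ℝ) (isAlgebraic_algebraMap (q : ℚ))
    (KZ.mzvRep u hu (KZ.mzvIntegrand_isSemialgebraicFunOn_holds u)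
      (KZ.mzvIntegrand_integrableOn_holds u hu))

/-- Auxiliary step `canonA_integrand`. [bookkeeping] -/
theorem canonA_integrand (u : List ℕ) (hu : MZV.IsAdmissible u) (q : ℚ) (t : Fin (MZV.weight u) → ℝ) :
    (canonA u hu q).integrand t = (q : ℝ) * KZ.mzvIntegrand u t := rfl

/-- … and a word generator of weight `≤ N` for `w ≤ N`. -/
theorem of_canonA_mem_wordGensLE (u : List ℕ) (hu : MZV.IsAdmissible u) (q : ℚ) {N : ℕ}
    (hN : MZV.weight u ≤ N) : KZ.of (canonA u hu q) ∈ wordGensLE N :=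
  ⟨MZV.weight u, fun i => (MZV.binaryWord u).getD i false, q, canonA u hu q, hN, rfl, fun t _ => by
    simp only [canonA_integrand, mzvIntegrand_eq_wordFun, wordFun, Rat.cast_one, one_mul], rfl⟩

/-- The integrand of `[Δ_w, q·ω_u]` as a word form, for any letter function `ε` agreeing with `u`. -/
theorem canonA_integrand_word (u : List ℕ) (hu : MZV.IsAdmissible u) (ε : Fin (MZV.weight u) → Bool)
    (hε : ∀ i : Fin (MZV.weight u), (MZV.binaryWord u).getD i false = ε i) (q : ℚ) (t : Fin (MZV.weight u) → ℝ) :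
    (canonA u hu q).integrand t = (q : ℝ) * ∏ i, if ε i then 1 / (1 - t i) else 1 / t i := by
  simp only [canonA_integrand, mzvIntegrand_eq_wordFun, wordFun, Rat.cast_one, one_mul, hε]

/-! ### 8c  The typed memberships on ARBITRARY representatives, and `SpanAt 4` -/

end WeightFour
/-! ## §9 The dimension-3 rung packaged: item 28709 `GenusZeroThreeNormalForm` (rank 2) from the
weight-sharpened graded normal form in dimension `≤ 3` and two move-level supports — NO transcendence.

`GenusZeroThreeNormalForm` asks: every genus-zero `g` of dimension 3 is `≡ ℓ + z` with `ℓ` rational of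
dimension 2 and value `a₀ + b₀ζ(2)`, `z = [Δ₃, q/(t₀t₁(1−t₂))]`.  From `GZNormalFormW 3` (words of weight
`≤ 3`), the word-closure normal form `WordClosureNFThree` (the 15 words of weight `≤ 3` reduce to
`[pt, A] + [Δ₂, Q·ω₀₁] + [Δ₃, q·ω₀₀₁]`: divergence, duality `ω₀₁₁ ↔ ω₀₀₁`, additivity) and the packaging
`PackagingTwo` (`[pt, A] + [Δ₂, Q·ω₀₁] ≡` one rational representation of dimension 2), it follows. -/

section GenusZeroThree
open Summit.KontsevichZagierPeriods.KontsevichZagierPeriods.Theses.RootDecompZetaThreeFrontier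
  (GenusZeroThreeNormalForm)
/-- Auxiliary step `adm_two`. [bookkeeping] -/
private theorem adm_two : MZV.IsAdmissible [2] := by decide

/-- `[Δ₂, Q·ω₀ω₁]` (Kontsevich's `ζ(2)`). -/
def k2 (Q : ℚ) : KZ.IntegralRep 2 := canonA [2] adm_two Q

end GenusZeroThree
/-! ## §10 (gen 9) The three 28709 supports over the ROUTE FILE's own vocabulary (writer RECIPE 2026-08-30T09:39:16Z)

The route file `Theses/RootDecompZetaThreeFrontier.lean` imports `KZCalculusProofs`, `KZKernelConjectureForms`
and `KZRelationsLE` only: `KZ.mzvRep` / `MZV.*`, hence §8's `canonA` and §9's `k0`/`k2`/`k3`, are NOT in scope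
there.  Below, each of the three supports of item 28709 (`GZNormalFormW 3`, `WordClosureNFThree`,
`PackagingTwo`, §9) is re-typed as ONE `def … : Prop` over `KZ.IntegralRep / KZ.of / KZ.relations /
KZ.IntegralRep.IsRational` and Mathlib alone, the canonical representatives being replaced by universally
quantified representations pinned by «domain `=` the open ordered simplex, integrand `=` the explicit
rational function ON it» — the style of item 28709 itself (file `g9/bc/RouteVocab.lean` checks the verbatim
one-line forms against EXACTLY the route file's import list and namespace).  Then the by-name equivalences
with §9 and `GZNormalFormWThree' → WordClosureNFThree' → PackagingTwo' → GenusZeroThreeNormalForm`. -/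

section RouteVocabulary
open Summit.KontsevichZagierPeriods.KontsevichZagierPeriods.Theses.RootDecompZetaThreeFrontier
  (GenusZeroThreeNormalForm)
/-! ### 10a  The canonical representatives meet the route-vocabulary specifications -/

/-- Auxiliary step `binaryWord_two`. [bookkeeping] -/
private theorem binaryWord_two : ∀ i : Fin 2, (MZV.binaryWord [2]).getD i false = ![false, true] i := by
  decide

/-- Auxiliary step `k2_domain`. [bookkeeping] -/
theorem k2_domain (Q : ℚ) : (k2 Q).domain = {t | (∀ i, 0 < t i) ∧ (∀ i, t i < 1) ∧ StrictAnti t} := rfl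

/-- the integrand of `[Δ₂, Q·ω₀ω₁]` in the form the route spells it (valid at every point) -/
theorem k2_integrand (Q : ℚ) (t : Fin 2 → ℝ) : (k2 Q).integrand t = (Q : ℝ) / (t 0 * (1 - t 1)) := by
  refine (canonA_integrand_word [2] adm_two _ binaryWord_two Q t).trans ?_
  show (Q : ℝ) * ∏ i : Fin 2, (if (![false, true] : Fin 2 → Bool) i then 1 / (1 - t i) else 1 / t i) =
    (Q : ℝ) / (t 0 * (1 - t 1))
  simp only [Fin.prod_univ_two, div_eq_mul_inv, mul_inv]
  rw [if_neg (by decide : ¬ (![false, true] : Fin 2 → Bool) 0 = true),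
    if_pos (by decide : (![false, true] : Fin 2 → Bool) 1 = true)]
  ring

/-! ### 10b  The by-name equivalences and item 28709 from the primed forms -/

end RouteVocabulary
/-! ## §11 (gen 9) Kernel specimens and the low rungs of `GZNormalFormW` (critic NOTE 2026-08-30T09:31:16Z)

The junk battery IN THE KERNEL: the `k = 0` corner (`gzNormalFormW_zero`), the weight-`0` column of
every rung (`gz_free`, no singular variable: the landed `collapse_literal` with `S = ∅`), the identity
specimens `ζ(3)` and `ζ(2,1)` through `GZNormalFormW 3` (`specimen_zeta3`, `specimen_zeta21`: both data lie
IN `wordGensLE 3`, values `ζ(3)` and `ζ(2,1)`), `PackagingTwo` PROVED by two Newton–Leibniz moves and one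
rule-1b move (`packagingTwo_holds`), and the word-closure normal form reduced to the two named MOVE facts
of weight `≤ 3` (`wordClosureNFThree_of : DivergenceLEThree → DualityThree → WordClosureNFThree`).  The
`k = 1` rung in full is §12. -/

section Specimens
open Literature.ModelTheory.ExponentialFields (IsSemialgebraic)
open Summit.KontsevichZagierPeriods.KontsevichZagierPeriods.Theorems.RootDecompZetaThreeFrontierSupportCollapse
  (collapse_literal)
/-! ### 11a  Membership in the open ordered simplices of dimension `0, 1, 2` -/

/-- Auxiliary step `strictAnti_fin_one`. [bookkeeping] -/
private theorem strictAnti_fin_one (y : Fin 1 → ℝ) : StrictAnti y := fun a b hab =>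
  absurd hab (by rw [Subsingleton.elim a b]; exact lt_irrefl _)

/-- Membership in `simplex_one_iff`, unfolded. [bookkeeping] -/
private theorem mem_simplex_one_iff (y : Fin 1 → ℝ) : y ∈ KZ.openOrderedSimplex 1 ↔ 0 < y 0 ∧ y 0 < 1 := by
  constructor
  · rintro ⟨h0, h1, -⟩
    exact ⟨h0 0, h1 0⟩
  · rintro ⟨h0, h1⟩
    refine ⟨fun i => ?_, fun i => ?_, strictAnti_fin_one y⟩
    · rw [Fin.fin_one_eq_zero i]; exact h0
    · rw [Fin.fin_one_eq_zero i]; exact h1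

/-- Membership in `simplex_two_iff`, unfolded. [bookkeeping] -/
private theorem mem_simplex_two_iff (z : Fin 2 → ℝ) :
    z ∈ KZ.openOrderedSimplex 2 ↔ 0 < z 1 ∧ z 1 < z 0 ∧ z 0 < 1 := by
  constructor
  · rintro ⟨h0, h1, ha⟩
    exact ⟨h0 1, ha (show (0 : Fin 2) < 1 by decide), h1 0⟩
  · rintro ⟨h1, h10, h0⟩
    refine ⟨Fin.forall_fin_two.mpr ⟨h1.trans h10, h1⟩, Fin.forall_fin_two.mpr ⟨h0, h10.trans h0⟩,
      Fin.strictAnti_iff_succ_lt.mpr (Fin.forall_fin_one.mpr ?_)⟩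
    simpa using h10

/-! ### 11b  The `k = 0` corner and the weight-`0` column of every rung -/

end Specimens
end Summit.KontsevichZagierPeriods.RootDecompZetaThreeFrontier.WordLayer
end
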